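import Literature.AlgebraicGeometry.Motives.FlatFamilyCutOutByDegreeEquations
import Literature.AlgebraicGeometry.Motives.SubfamilyContainedInClosedFormsVanish   -- (v2) ★ p794354 β1: `app_injective_of_isIso` BY NAME (dedup re-cut)
import Literature.AlgebraicGeometry.Morphisms.ProjectiveSubschemeContainmentByForms
import Literature.AlgebraicGeometry.Modules.PushforwardBaseChangeOpenImmersion
import Literature.AlgebraicGeometry.Modules.SerreTwistModProjMap
import Literature.AlgebraicGeometry.Morphisms.ProjectiveSpaceOverBasePoints
import HarnessLib

/-!
# If the restricted forms `α_m` die after base change to `Spec A' → Spec A ⊆ T`, the sub-family lies in the fixed closed `W` there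
# (II-b (b1) FILE 2A-β, direction «equations ⇒ containment», the AFFINE CORE)

Layer `Literature/AlgebraicGeometry/Motives`, namespace `Literature.AlgebraicGeometry.Motives`.  THEOREMS ONLY (no `def`, no instance, no
notation, no named fact, no `sorry`); universe `0` (the universe of ★ PART B `Motives/FlatFamilyCutOutByDegreeEquations`).  Cell `hodgecm-mathlib`
(D-0151 ∕ FLOOR 0), P1 sub-line F-4 layer 2, sub-stub (II-b) «the Hom-scheme», brick (b1) «sub-families inside a fixed closed `W ⊂ 𝐏(ι; T)` form a
closed sub-functor», FILE 2A-β (B-p20 (g14) blueprint `BLUEPRINT-F4-IIb-b1-FILE2A` §2 (5)+(6); author B-p20 (g15)).  Count-neutral capital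
(`--supports stmt-HodgeConjecture-24835`); HC_CM is proved only modulo the 7 printed citations until rung 0 closes, and nothing here bears on it.

## The source, as printed

[Kollar1996] I Thm. 1.10 (proof) and [MumfordFogartyKirwan1994] Ch. 0 §5 (c) (p. 23): `Hilb(W/S) ⊂ Hilb(ℙ/S)` is cut out by the vanishing of the
equations of `W` restricted to the universal family.  The scheme-theoretic content of the hard half, over an affine open `Spec A ⊆ T` (`A`
Noetherian) and an `A`-algebra `A'`: the homogeneous ideal `𝔞(W_A)` of `W_A ⊂ ℙⁿ_A` is generated in degrees `≤ d₀` ([Hartshorne1977] II Ex. 5.10),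
its degree-`m` piece is spanned by the monomial-section relations `Σ_w c_w x^w` with `Σ_w c_w • μ_w|_{W} = 0` ([Hartshorne1977] II Cor. 5.16 (a),
II Prop. 5.12 (c), ★ PART A dictionary), and `Z_{A'} ⊂ W_{A'}` as soon as `𝔞(W_A)_m ⊗ 1 ⊆ 𝔞(Z_{A'})` for one `m ≥ d₀` (★ FILE 2B
`Morphisms/ProjectiveSubschemeContainmentByForms`); the base change of the relations is [Hartshorne1977] III Prop. 9.3 (p. 255) (★ PART A §3).

## Setting

`T` a scheme, `𝐏(ι; T) = T × 𝐏ⁿ_ℤ` (★ `Morphisms.projectiveSpace`, `n = Nat.card ι`, `πT`, `ιP = pullback.snd`), TWO closed families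
`i : Z ⟶ 𝐏(ι; T)`, `iW : W ⟶ 𝐏(ι; T)` with monomial maps `ψ_{Z,m}`, `ψ_{W,m}` (binders with the letter `hψ` of ★ PART B), `α_m := kernel.ι ψ_{W,m} ≫ ψ_{Z,m}`;
a point `x : Spec A → T` with values in a ring `A`, the cartesian lift `kP : ℙⁿ_A → 𝐏(ι; T)` (★ `isPullback_projectiveSpace_fieldPoint`, ring-general),
and for an `A`-algebra `A'` the base change `κ : ℙⁿ_{A'} → ℙⁿ_A` (Mathlib `Proj.map`, ★ `ProjBaseChangeRing.isPullback_projMap'`).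

## Statements

* §1 generic: (`app_injective_of_isIso` = ★ β1 `SubfamilyContainedInClosedFormsVanish` BY NAME since v2), `unitSectionLE_injective_of_isOpenImmersion` (`η_x` is injective on sections over `x(⊤)` for an open
  immersion `x`, Mathlib `restrictFunctorIsoPullback` via ★ `restrictFunctorIsoPullback_hom_app_eq`), `appLE_appIso_inv_top`, `ΓSpecIso_hom_comp_appLE_top`.
* §2 presented points (ANY ring `A`, square `X₀ → Z` cartesian over `x` PRESENTED by `ιA : X₀ ↪ ℙⁿ_A` over `A`, transport `Φ₀` of `𝒪(d)` taking
  monomials to monomials): (Z) `wordPolynomial_mem_idealZ_of_unitSectionLE_app_eq_zero` — if `η_x(ψ(Σ_w c_w ε_w)) = 0` then `Σ_w x♯(c_w) x^w ∈ 𝔞(X₀)`;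
  (W) `app_monomialMap_eq_zero_of_wordPolynomial_mem_idealZ` — for `x` an OPEN IMMERSION, conversely `Σ_w x♯(c_w) x^w ∈ 𝔞(X₀)` forces
  `ψ(Σ_w c_w ε_w) = 0` over `x(⊤)` (base change along an open immersion is an isomorphism, ★ `Modules/PushforwardBaseChangeOpenImmersion`).
* §3 `exists_presentations` — the presentations `W_A := W ×_{𝐏(ι;T)} ℙⁿ_A ↪ ℙⁿ_A` and `Z_{A'} := Z ×_{𝐏(ι;T)} ℙⁿ_{A'} ↪ ℙⁿ_{A'}` (over `κ ≫ kP`) with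
  their monomial-preserving transports (★ `SerreTwist.exists_twistMod_comp_projMap_iso`, identity transports of ★ PART A §4).
* §4 **`ker_comap_le_of_forall_pullback_map_eq_zero_affine`** — for `x : Spec A → T` an OPEN IMMERSION with `A` Noetherian and an `A`-algebra `A'`:
  if `(Spec A' → Spec A → T)^* α_m = 0` for all `m ≥ m₀`, then `𝓘_W · 𝒪 ≤ 𝓘_Z · 𝒪` on `𝐏(ι; Spec A')` along `𝐏(Spec A' → T)`, i.e. `Z_{A'} ⊂ W_{A'}`.

## References
* [Kollar1996] J. Kollár, *Rational Curves on Algebraic Varieties* (1996), I Thm. 1.10 (proof).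
* [MumfordFogartyKirwan1994] D. Mumford, J. Fogarty, F. Kirwan, *Geometric Invariant Theory*, 3rd ed. (1994), Ch. 0 §5 (c) (p. 23).
* [Mumford1966CurvesSurface] D. Mumford, *Lectures on Curves on an Algebraic Surface* (1966), Lecture 15 (IV.)–(V.) (pp. 107–108).
* [Hartshorne1977] R. Hartshorne, *Algebraic Geometry* (1977), II Prop. 5.12 (c) (p. 117), II Cor. 5.16 (a) (p. 119), II Ex. 5.10 (p. 125), II §5 (p. 110),
  II Thm. 3.3 (p. 87), III Prop. 9.3 (p. 255), II Ex. 3.11 (a) (p. 92).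
* [GortzWedhorn2020] U. Görtz, T. Wedhorn, *Algebraic Geometry I*, 2nd ed. (2020), Prop. 4.20 (p. 104), Section (4.12) (p. 113).
-/

noncomputable section

-- `TopCat.Presheaf`/`Scheme.Modules` are not reducible (as in Mathlib's `AlgebraicGeometry/Modules/Sheaf.lean`).
set_option backward.isDefEq.respectTransparency false

open CategoryTheory CategoryTheory.Limits CategoryTheory.Abelian AlgebraicGeometry TopologicalSpace Opposite
open Literature.Algebra.Homology Literature.Algebra.Homology.LaurentCech
open Literature.AlgebraicGeometry.Morphisms Literature.AlgebraicGeometry.Morphisms.ProjCech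
open Literature.AlgebraicGeometry.Modules Literature.AlgebraicGeometry.Modules.SerreTwist

namespace Literature.AlgebraicGeometry.Motives

/-! ### §1 Generic lemmas -/

section Generic

/-- **`η_x` is injective over the image of an open immersion**: for an open immersion `x : S → T` and an `𝒪_T`-module `G`, the pulled-back section
map `Γ(G, x(⊤)) → Γ(x^* G, ⊤)`, `y ↦ η_x(y)|_⊤`, is injective — it is the component of Mathlib's isomorphism `restrictFunctorIsoPullback x` (★
`restrictFunctorIsoPullback_hom_app_eq`). [cite: Hartshorne1977, II §5 (p. 110)] -/
theorem unitSectionLE_injective_of_isOpenImmersion {S T : Scheme.{0}} (x : S ⟶ T) [IsOpenImmersion x] (G : T.Modules)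
    (hle : (⊤ : S.Opens) ≤ x ⁻¹ᵁ (x ''ᵁ ⊤)) :
    Function.Injective (unitSectionLE x G hle : Γ(G, x ''ᵁ ⊤) → Γ((Scheme.Modules.pullback x).obj G, ⊤)) := by
  have key : ∀ y : Γ(G, x ''ᵁ ⊤), unitSectionLE x G hle y =
      ((Scheme.Modules.restrictFunctorIsoPullback x).hom.app G).app ⊤ (show Γ(G.restrict x, ⊤) from y) := fun y => by
    rw [restrictFunctorIsoPullback_hom_app_eq]
    exact presheaf_map_congr _ _ _ _
  intro y₁ y₂ h
  rw [key, key] at h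
  exact (ConcreteCategory.bijective_of_isIso (((Scheme.Modules.restrictFunctorIsoPullback x).hom.app G).app ⊤)).1 h

/-- `x♯|_⊤ ∘ (x.appIso ⊤)⁻¹ = id` on `Γ(S, ⊤)` for an open immersion `x : S → T` (Mathlib `appIso_inv_appLE`). [cite: Hartshorne1977, II §5 (p. 110)] -/
theorem appLE_appIso_inv_top {S T : Scheme.{0}} (x : S ⟶ T) [IsOpenImmersion x] (hle : (⊤ : S.Opens) ≤ x ⁻¹ᵁ (x ''ᵁ ⊤)) (z : Γ(S, ⊤)) :
    x.appLE (x ''ᵁ ⊤) ⊤ hle ((x.appIso ⊤).inv z) = z := by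
  have hid : ∀ k : (⊤ : S.Opens) ⟶ ⊤, S.presheaf.map k.op z = z := fun k => by
    rw [Subsingleton.elim k (𝟙 _), op_id, CategoryTheory.Functor.map_id]
    rfl
  rw [← CategoryTheory.comp_apply, Scheme.Hom.appIso_inv_appLE]
  exact hid _

/-- **Constants through `Spec A' → Spec A → T`**: for `f : R ⟶ S` and `x : Spec R → T`, `(Spec f ≫ x)♯|_⊤ (z) = f (x♯|_⊤ (z))` under the identifications
`Γ(Spec R, ⊤) = R`, `Γ(Spec S, ⊤) = S` (Mathlib `ΓSpecIso_naturality`). [cite: Hartshorne1977, II Prop. 2.3 (p. 73)] -/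
theorem ΓSpecIso_hom_comp_appLE_top {R S : CommRingCat.{0}} (f : R ⟶ S) {T : Scheme.{0}} (x : Spec R ⟶ T) {V : T.Opens}
    (hle : (⊤ : (Spec R).Opens) ≤ x ⁻¹ᵁ V) (hle' : (⊤ : (Spec S).Opens) ≤ (Spec.map f ≫ x) ⁻¹ᵁ V) (z : Γ(T, V)) :
    (Scheme.ΓSpecIso S).hom ((Spec.map f ≫ x).appLE V ⊤ hle' z) = f ((Scheme.ΓSpecIso R).hom (x.appLE V ⊤ hle z)) := by
  have happ : (Spec.map f).appLE ⊤ ⊤ le_top = (Spec.map f).appTop := Scheme.Hom.appLE_eq_app _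
  have hcomp : (Spec.map f ≫ x).appLE V ⊤ hle' = x.appLE V ⊤ hle ≫ (Spec.map f).appTop := by
    rw [← happ]
    exact (Scheme.Hom.appLE_comp_appLE (Spec.map f) x V ⊤ ⊤ hle le_top).symm
  rw [hcomp, CategoryTheory.comp_apply, ← CategoryTheory.comp_apply, Scheme.ΓSpecIso_naturality, CategoryTheory.comp_apply]

end Generic

/-! ### §2 Presented points: relations among monomial sections versus forms of the homogeneous ideal -/

section Presented

variable {ι : Type} {T Z : Scheme.{0}} (i : Z ⟶ Morphisms.projectiveSpace ι T) (d : ℕ)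
  (ψ : freeModule T (Fin d → Fin (Nat.card ι + 1)) ⟶ (Scheme.Modules.pushforward (i ≫ Morphisms.projectiveSpaceFst ι T)).obj
    (twistMod (i ≫ pullback.snd (terminal.from T) (terminal.from (Morphisms.projectiveSpaceInt ι))) (unitModule Z) d))
  (hψ : ∀ (w : Fin d → Fin (Nat.card ι + 1)) (V : T.Opens), ψ.app V (freeSectionOn T w V) =
    ((Scheme.Modules.pushforward (i ≫ Morphisms.projectiveSpaceFst ι T)).obj
      (twistMod (i ≫ pullback.snd (terminal.from T) (terminal.from (Morphisms.projectiveSpaceInt ι))) (unitModule Z) d)).presheaf.map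
      (homOfLE (le_top : V ≤ ⊤)).op
      (show Γ((Scheme.Modules.pushforward (i ≫ Morphisms.projectiveSpaceFst ι T)).obj
        (twistMod (i ≫ pullback.snd (terminal.from T) (terminal.from (Morphisms.projectiveSpaceInt ι))) (unitModule Z) d), ⊤) from
        monomialSection (i ≫ pullback.snd (terminal.from T) (terminal.from (Morphisms.projectiveSpaceInt ι))) d w))
  {A : Type} [CommRing A] {x : Spec (CommRingCat.of A) ⟶ T} {X₀ : Scheme.{0}} {kX : X₀ ⟶ Z} {ιA : X₀ ⟶ PP A (Nat.card ι)}
  (HX : IsPullback kX (ιA ≫ toSpec A (Nat.card ι)) (i ≫ Morphisms.projectiveSpaceFst ι T) x)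
  (Φ₀ : twistMod (kX ≫ i ≫ pullback.snd (terminal.from T) (terminal.from (Morphisms.projectiveSpaceInt ι))) (unitModule X₀) d ≅
    twistMod ιA (unitModule X₀) d)
  (hΦ₀ : ∀ w : Fin d → Fin (Nat.card ι + 1),
    Φ₀.hom.app ⊤ (monomialSection (kX ≫ i ≫ pullback.snd (terminal.from T) (terminal.from (Morphisms.projectiveSpaceInt ι))) d w) =
      monomialSection ιA d w)

include HX hψ hΦ₀ in
/-- **(Z) A relation among the pulled-back monomial sections is a form of the homogeneous ideal of the presented base change.**  Let
`X₀ → Z` be cartesian over `x : Spec A → T`, presented as `ιA : X₀ ⊆ ℙⁿ_A` over `A` with the transport `Φ₀` of `𝒪(d)`; let `V ⊆ T` be an open through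
which `x` factors and `c_w ∈ Γ(T, V)`.  If `η_x(ψ(Σ_w c_w ε_w|_V)) = 0` in `Γ(Spec A, x^*(p_Z)_* 𝒪_Z(d))`, then the degree-`d` form `Σ_w x♯(c_w) x^w` lies in
`𝔞(X₀ ⊆ ℙⁿ_A)` — ★ PART A §3 (base change of `ψ`) and THE DICTIONARY (★ PART A §2). [cite: Mumford1966CurvesSurface, Lecture 15 (IV.)–(V.) (pp. 107–108)]
[cite: Hartshorne1977, II Cor. 5.16 (a) (p. 119) and III Prop. 9.3 (p. 255)] -/
theorem wordPolynomial_mem_idealZ_of_unitSectionLE_app_eq_zero {V : T.Opens} (hle : (⊤ : (Spec (CommRingCat.of A)).Opens) ≤ x ⁻¹ᵁ V)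
    (c : (Fin d → Fin (Nat.card ι + 1)) → Γ(T, V))
    (h0 : unitSectionLE x ((Scheme.Modules.pushforward (i ≫ Morphisms.projectiveSpaceFst ι T)).obj
      (twistMod (i ≫ pullback.snd (terminal.from T) (terminal.from (Morphisms.projectiveSpaceInt ι))) (unitModule Z) d)) hle
      (ψ.app V (∑ w, c w • freeSectionOn T w V)) = 0) :
    (∑ w, MvPolynomial.C ((Scheme.ΓSpecIso (CommRingCat.of A)).hom (x.appLE V ⊤ hle (c w))) * ∏ t, MvPolynomial.X (w t) :
      P A (Nat.card ι)) ∈ idealZ ιA := by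
  have key := baseChange_app_sum_smul_unitSectionLE
    (i ≫ pullback.snd (terminal.from T) (terminal.from (Morphisms.projectiveSpaceInt ι))) ιA HX d ψ hψ Φ₀ hΦ₀ hle
    fun w => x.appLE V ⊤ hle (c w)
  rw [← unitSectionLE_sum_smul, Scheme.Modules.Hom.comp_app, CategoryTheory.comp_apply, pullback_map_app_unitSectionLE, h0, map_zero] at key
  exact (sum_smul_monomialSection_res_eq_zero_iff ιA fun w => x.appLE V ⊤ hle (c w)).mp key.symm

include HX hψ hΦ₀ in
/-- **(W) Conversely, over an OPEN IMMERSION `x : Spec A → T`: a form of the homogeneous ideal of the presented base change is a relation.**  With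
`V := x(⊤)` and `c_w ∈ Γ(T, V)`: if `Σ_w x♯(c_w) x^w ∈ 𝔞(X₀ ⊆ ℙⁿ_A)` then `ψ(Σ_w c_w ε_w|_V) = 0` in `Γ(V, (p_Z)_* 𝒪_Z(d))` — THE DICTIONARY gives
`Σ_w x♯(c_w) • μ_w|_{X₀} = 0`, which is the image of `η_x(ψ(Σ_w c_w ε_w))` under the base-change ISOMORPHISM along the open immersion `x` (★
`isIso_pushforwardBaseChangeHom_of_isOpenImmersion`, ★ `isIso_pullbackTwistHom`), and `η_x` is injective over `x(⊤)`.
[cite: Hartshorne1977, II Cor. 5.16 (a) (p. 119) and III Prop. 9.3 (p. 255)] [cite: Mumford1966CurvesSurface, Lecture 15 (IV.)–(V.) (pp. 107–108)] -/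
theorem app_monomialMap_eq_zero_of_wordPolynomial_mem_idealZ [IsOpenImmersion x]
    (hle : (⊤ : (Spec (CommRingCat.of A)).Opens) ≤ x ⁻¹ᵁ (x ''ᵁ ⊤)) (c : (Fin d → Fin (Nat.card ι + 1)) → Γ(T, x ''ᵁ ⊤))
    (hmem : (∑ w, MvPolynomial.C ((Scheme.ΓSpecIso (CommRingCat.of A)).hom (x.appLE (x ''ᵁ ⊤) ⊤ hle (c w))) *
      ∏ t, MvPolynomial.X (w t) : P A (Nat.card ι)) ∈ idealZ ιA) :
    ψ.app (x ''ᵁ ⊤) (∑ w, c w • freeSectionOn T w (x ''ᵁ ⊤)) = 0 := by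
  -- `η_x` is injective on sections over `x(⊤)`
  apply unitSectionLE_injective_of_isOpenImmersion x _ hle
  rw [unitSectionLE_zero]
  -- the base-change composite along the open immersion `x` is an isomorphism
  haveI := isIso_pushforwardBaseChangeHom_of_isOpenImmersion HX
    (twistMod (i ≫ pullback.snd (terminal.from T) (terminal.from (Morphisms.projectiveSpaceInt ι))) (unitModule Z) d)
  haveI := isIso_pullbackTwistHom kX (i ≫ pullback.snd (terminal.from T) (terminal.from (Morphisms.projectiveSpaceInt ι))) d
  apply app_injective_of_isIso (pushforwardBaseChangeHom HX.w
      (twistMod (i ≫ pullback.snd (terminal.from T) (terminal.from (Morphisms.projectiveSpaceInt ι))) (unitModule Z) d) ≫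
    (Scheme.Modules.pushforward (ιA ≫ toSpec A (Nat.card ι))).map
      (pullbackTwistHom kX (i ≫ pullback.snd (terminal.from T) (terminal.from (Morphisms.projectiveSpaceInt ι))) d ≫ Φ₀.hom)) ⊤
  rw [map_zero, ← pullback_map_app_unitSectionLE, ← CategoryTheory.comp_apply, ← Scheme.Modules.Hom.comp_app]
  have key := baseChange_app_sum_smul_unitSectionLE
    (i ≫ pullback.snd (terminal.from T) (terminal.from (Morphisms.projectiveSpaceInt ι))) ιA HX d ψ hψ Φ₀ hΦ₀ hle
    fun w => x.appLE (x ''ᵁ ⊤) ⊤ hle (c w)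
  rw [← unitSectionLE_sum_smul] at key
  rw [key]
  exact (sum_smul_monomialSection_res_eq_zero_iff ιA fun w => x.appLE (x ''ᵁ ⊤) ⊤ hle (c w)).mpr hmem

end Presented

/-! ### §3 The presentations of `W_A` and `Z_{A'}` with their transports -/

section Presentations

variable {ι : Type} {T Z W : Scheme.{0}} (i : Z ⟶ Morphisms.projectiveSpace ι T) [IsClosedImmersion i]
  (iW : W ⟶ Morphisms.projectiveSpace ι T) [IsClosedImmersion iW]

/-- **Presentations of the base changes.**  For a point `x : Spec A → T` and an `A`-algebra `A'` there are: the cartesian lift `kP : ℙⁿ_A → 𝐏(ι; T)`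
over `x` (★ `isPullback_projectiveSpace_fieldPoint`, components `(ℙⁿ_A → Spec A → T, Proj (ℤ[x] → A[x]))`); the presentation
`ιWA : W_A := W ×_{𝐏(ι;T)} ℙⁿ_A ↪ ℙⁿ_A` (a base change of `iW`) with, for every `d`, a transport of `𝒪_W(d)` to `𝒪_{W_A}(d)` taking monomials to
monomials; and, over the composite `κ ≫ kP` with `κ = Proj (A[x] → A'[x]) : ℙⁿ_{A'} → ℙⁿ_A`, the presentation
`ι' : Z_{A'} := Z ×_{𝐏(ι;T)} ℙⁿ_{A'} ↪ ℙⁿ_{A'}` with the transports of `𝒪_Z(d)` — identity transports along equalities of structure maps (★ PART A §4)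
composed with the transports along `Proj (ℤ[x] → A[x])`, `Proj (A[x] → A'[x])` (★ `SerreTwist.exists_twistMod_comp_projMap_iso`).
[cite: Hartshorne1977, II Thm. 3.3 (p. 87) and II Prop. 5.12 (c) (p. 117)] [cite: GortzWedhorn2020, Section (4.12) (p. 113) and Prop. 4.20 (p. 104)] -/
theorem exists_presentations {A : Type} [CommRing A] (x : Spec (CommRingCat.of A) ⟶ T) (A' : Type) [CommRing A'] [Algebra A A'] :
    letI := MvPolynomial.gradedAlgebra (σ := Fin (Nat.card ι + 1)) (R := A)
    letI := MvPolynomial.gradedAlgebra (σ := Fin (Nat.card ι + 1)) (R := A')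
    ∃ (kP : PP A (Nat.card ι) ⟶ Morphisms.projectiveSpace ι T)
      (_ : IsPullback kP (toSpec A (Nat.card ι)) (Morphisms.projectiveSpaceFst ι T) x)
      (WA : Scheme.{0}) (kXW : WA ⟶ W) (ιWA : WA ⟶ PP A (Nat.card ι)) (_ : IsClosedImmersion ιWA) (_ : IsPullback ιWA kXW kP iW)
      (_ : ∀ d : ℕ, ∃ ΦW : twistMod (kXW ≫ iW ≫ pullback.snd (terminal.from T) (terminal.from (Morphisms.projectiveSpaceInt ι)))
          (unitModule WA) d ≅ twistMod ιWA (unitModule WA) d,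
        ∀ w : Fin d → Fin (Nat.card ι + 1),
          ΦW.hom.app ⊤ (monomialSection (kXW ≫ iW ≫ pullback.snd (terminal.from T) (terminal.from (Morphisms.projectiveSpaceInt ι))) d w) =
            monomialSection ιWA d w)
      (X₁ : Scheme.{0}) (kX' : X₁ ⟶ Z) (ι' : X₁ ⟶ PP A' (Nat.card ι)) (_ : IsClosedImmersion ι')
      (_ : IsPullback ι' kX' (Proj.map (ProjBaseChangeRing.mapGraded A A' (Fin (Nat.card ι + 1)))
        (ProjBaseChangeRing.irrelevant_le_map A A' (Fin (Nat.card ι + 1))) ≫ kP) i),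
      ∀ d : ℕ, ∃ Φ : twistMod (kX' ≫ i ≫ pullback.snd (terminal.from T) (terminal.from (Morphisms.projectiveSpaceInt ι))) (unitModule X₁) d ≅
          twistMod ι' (unitModule X₁) d,
        ∀ w : Fin d → Fin (Nat.card ι + 1),
          Φ.hom.app ⊤ (monomialSection (kX' ≫ i ≫ pullback.snd (terminal.from T) (terminal.from (Morphisms.projectiveSpaceInt ι))) d w) =
            monomialSection ι' d w := by
  letI := MvPolynomial.gradedAlgebra (σ := Fin (Nat.card ι + 1)) (R := A)
  letI := MvPolynomial.gradedAlgebra (σ := Fin (Nat.card ι + 1)) (R := A')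
  letI := MvPolynomial.gradedAlgebra (σ := Fin (Nat.card ι + 1)) (R := intU.{0})
  letI : Algebra intU.{0} A := ULift.algebra' (R := ℤ) (A := A)
  -- the cartesian lift `kP` over `x`, second component `Proj (ℤ[x] → A[x])`
  have HC := isPullback_projectiveSpace_fieldPoint (ι := ι) (T := T) (K := A) x
  set kP : PP A (Nat.card ι) ⟶ Morphisms.projectiveSpace ι T :=
    pullback.lift (ProjBaseChangeRing.projToSpec (Fin (Nat.card ι + 1)) A ≫ x)
      (Proj.map (ProjBaseChangeRing.mapGraded intU.{0} A (Fin (Nat.card ι + 1)))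
        (ProjBaseChangeRing.irrelevant_le_map intU.{0} A (Fin (Nat.card ι + 1))))
      (by simp only [Category.assoc]; exact terminal.hom_ext _ _) with hkPdef
  have hkP : kP ≫ pullback.snd (terminal.from T) (terminal.from (Morphisms.projectiveSpaceInt ι)) =
      Proj.map (ProjBaseChangeRing.mapGraded intU.{0} A (Fin (Nat.card ι + 1)))
        (ProjBaseChangeRing.irrelevant_le_map intU.{0} A (Fin (Nat.card ι + 1))) := by
    rw [hkPdef, pullback.lift_snd]
  -- `W_A`
  have SW : IsPullback (pullback.fst iW kP) (pullback.snd iW kP) iW kP := IsPullback.of_hasPullback iW kP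
  have hιW : pullback.fst iW kP ≫ iW ≫ pullback.snd (terminal.from T) (terminal.from (Morphisms.projectiveSpaceInt ι)) =
      pullback.snd iW kP ≫ Proj.map (ProjBaseChangeRing.mapGraded intU.{0} A (Fin (Nat.card ι + 1)))
        (ProjBaseChangeRing.irrelevant_le_map intU.{0} A (Fin (Nat.card ι + 1))) := by
    rw [← Category.assoc, SW.w, Category.assoc, hkP]
  have hTW : ∀ d : ℕ, ∃ ΦW : twistMod (pullback.fst iW kP ≫ iW ≫ pullback.snd (terminal.from T) (terminal.from (Morphisms.projectiveSpaceInt ι)))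
        (unitModule (pullback iW kP)) d ≅ twistMod (pullback.snd iW kP) (unitModule (pullback iW kP)) d,
      ∀ w : Fin d → Fin (Nat.card ι + 1),
        ΦW.hom.app ⊤ (monomialSection (pullback.fst iW kP ≫ iW ≫ pullback.snd (terminal.from T)
          (terminal.from (Morphisms.projectiveSpaceInt ι))) d w) = monomialSection (pullback.snd iW kP) d w := by
    intro d
    obtain ⟨ΦW₁, hΦW₁⟩ := exists_twistMod_iso_of_structureMap_eq hιW d
    obtain ⟨ΦW₂, hΦW₂⟩ := exists_twistMod_comp_projMap_iso intU.{0} A (pullback.snd iW kP) (unitModule (pullback iW kP)) d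
    have hΦW₂' := fun wd : Fin d → Fin (Nat.card ι + 1) => app_monomialSection_of_comp_eq _ _
      (fun j => (Zop_comp_projMap intU.{0} A (pullback.snd iW kP) {j}).ge)
      (map_chartFun_comp_projMap intU.{0} A (pullback.snd iW kP)) d ΦW₂.hom hΦW₂ wd
    refine ⟨ΦW₁ ≪≫ ΦW₂, fun wd => ?_⟩
    change ΦW₂.hom.app ⊤ (ΦW₁.hom.app ⊤ (monomialSection _ d wd)) = _
    rw [hΦW₁, hΦW₂']
  -- `Z_{A'}` over `κ ≫ kP`
  have SZ : IsPullback (pullback.fst i (Proj.map (ProjBaseChangeRing.mapGraded A A' (Fin (Nat.card ι + 1)))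
        (ProjBaseChangeRing.irrelevant_le_map A A' (Fin (Nat.card ι + 1))) ≫ kP))
      (pullback.snd i (Proj.map (ProjBaseChangeRing.mapGraded A A' (Fin (Nat.card ι + 1)))
        (ProjBaseChangeRing.irrelevant_le_map A A' (Fin (Nat.card ι + 1))) ≫ kP)) i
      (Proj.map (ProjBaseChangeRing.mapGraded A A' (Fin (Nat.card ι + 1)))
        (ProjBaseChangeRing.irrelevant_le_map A A' (Fin (Nat.card ι + 1))) ≫ kP) := IsPullback.of_hasPullback _ _
  have hιZ : pullback.fst i (Proj.map (ProjBaseChangeRing.mapGraded A A' (Fin (Nat.card ι + 1)))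
          (ProjBaseChangeRing.irrelevant_le_map A A' (Fin (Nat.card ι + 1))) ≫ kP) ≫ i ≫
        pullback.snd (terminal.from T) (terminal.from (Morphisms.projectiveSpaceInt ι)) =
      (pullback.snd i (Proj.map (ProjBaseChangeRing.mapGraded A A' (Fin (Nat.card ι + 1)))
          (ProjBaseChangeRing.irrelevant_le_map A A' (Fin (Nat.card ι + 1))) ≫ kP) ≫
        Proj.map (ProjBaseChangeRing.mapGraded A A' (Fin (Nat.card ι + 1))) (ProjBaseChangeRing.irrelevant_le_map A A' (Fin (Nat.card ι + 1)))) ≫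
        Proj.map (ProjBaseChangeRing.mapGraded intU.{0} A (Fin (Nat.card ι + 1)))
          (ProjBaseChangeRing.irrelevant_le_map intU.{0} A (Fin (Nat.card ι + 1))) := by
    rw [← Category.assoc, SZ.w]
    simp only [Category.assoc, hkP]
  have hTZ : ∀ d : ℕ, ∃ Φ : twistMod (pullback.fst i (Proj.map (ProjBaseChangeRing.mapGraded A A' (Fin (Nat.card ι + 1)))
          (ProjBaseChangeRing.irrelevant_le_map A A' (Fin (Nat.card ι + 1))) ≫ kP) ≫ i ≫
        pullback.snd (terminal.from T) (terminal.from (Morphisms.projectiveSpaceInt ι))) (unitModule _) d ≅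
        twistMod (pullback.snd i (Proj.map (ProjBaseChangeRing.mapGraded A A' (Fin (Nat.card ι + 1)))
          (ProjBaseChangeRing.irrelevant_le_map A A' (Fin (Nat.card ι + 1))) ≫ kP)) (unitModule _) d,
      ∀ w : Fin d → Fin (Nat.card ι + 1),
        Φ.hom.app ⊤ (monomialSection (pullback.fst i (Proj.map (ProjBaseChangeRing.mapGraded A A' (Fin (Nat.card ι + 1)))
            (ProjBaseChangeRing.irrelevant_le_map A A' (Fin (Nat.card ι + 1))) ≫ kP) ≫ i ≫
          pullback.snd (terminal.from T) (terminal.from (Morphisms.projectiveSpaceInt ι))) d w) =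
          monomialSection (pullback.snd i (Proj.map (ProjBaseChangeRing.mapGraded A A' (Fin (Nat.card ι + 1)))
            (ProjBaseChangeRing.irrelevant_le_map A A' (Fin (Nat.card ι + 1))) ≫ kP)) d w := by
    intro d
    obtain ⟨Φ₁, hΦ₁⟩ := exists_twistMod_iso_of_structureMap_eq hιZ d
    obtain ⟨Φ₂, hΦ₂⟩ := exists_twistMod_comp_projMap_iso intU.{0} A
      (pullback.snd i (Proj.map (ProjBaseChangeRing.mapGraded A A' (Fin (Nat.card ι + 1)))
          (ProjBaseChangeRing.irrelevant_le_map A A' (Fin (Nat.card ι + 1))) ≫ kP) ≫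
        Proj.map (ProjBaseChangeRing.mapGraded A A' (Fin (Nat.card ι + 1))) (ProjBaseChangeRing.irrelevant_le_map A A' (Fin (Nat.card ι + 1))))
      (unitModule _) d
    have hΦ₂' := fun wd : Fin d → Fin (Nat.card ι + 1) => app_monomialSection_of_comp_eq _ _
      (fun j => (Zop_comp_projMap intU.{0} A _ {j}).ge) (map_chartFun_comp_projMap intU.{0} A _) d Φ₂.hom hΦ₂ wd
    obtain ⟨Φ₃, hΦ₃⟩ := exists_twistMod_comp_projMap_iso A A'
      (pullback.snd i (Proj.map (ProjBaseChangeRing.mapGraded A A' (Fin (Nat.card ι + 1)))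
        (ProjBaseChangeRing.irrelevant_le_map A A' (Fin (Nat.card ι + 1))) ≫ kP)) (unitModule _) d
    have hΦ₃' := fun wd : Fin d → Fin (Nat.card ι + 1) => app_monomialSection_of_comp_eq _ _
      (fun j => (Zop_comp_projMap A A' _ {j}).ge) (map_chartFun_comp_projMap A A' _) d Φ₃.hom hΦ₃ wd
    refine ⟨Φ₁ ≪≫ Φ₂ ≪≫ Φ₃, fun wd => ?_⟩
    change Φ₃.hom.app ⊤ (Φ₂.hom.app ⊤ (Φ₁.hom.app ⊤ (monomialSection _ d wd))) = _
    rw [hΦ₁, hΦ₂', hΦ₃']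
  exact ⟨kP, HC, pullback iW kP, pullback.fst iW kP, pullback.snd iW kP, inferInstance, SW.flip, hTW,
    pullback i _, pullback.fst i _, pullback.snd i _, inferInstance, SZ.flip, hTZ⟩

end Presentations

/-! ### §4 The affine core: equations force containment -/

section Core

variable {ι : Type} {T Z W : Scheme.{0}} (i : Z ⟶ Morphisms.projectiveSpace ι T) [IsClosedImmersion i]
  (iW : W ⟶ Morphisms.projectiveSpace ι T) [IsClosedImmersion iW]
  (ψZ : ∀ m : ℕ, freeModule T (Fin m → Fin (Nat.card ι + 1)) ⟶ (Scheme.Modules.pushforward (i ≫ Morphisms.projectiveSpaceFst ι T)).obj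
    (twistMod (i ≫ pullback.snd (terminal.from T) (terminal.from (Morphisms.projectiveSpaceInt ι))) (unitModule Z) m))
  (hψZ : ∀ (m : ℕ) (w : Fin m → Fin (Nat.card ι + 1)) (V : T.Opens), (ψZ m).app V (freeSectionOn T w V) =
    ((Scheme.Modules.pushforward (i ≫ Morphisms.projectiveSpaceFst ι T)).obj
      (twistMod (i ≫ pullback.snd (terminal.from T) (terminal.from (Morphisms.projectiveSpaceInt ι))) (unitModule Z) m)).presheaf.map
      (homOfLE (le_top : V ≤ ⊤)).op
      (show Γ((Scheme.Modules.pushforward (i ≫ Morphisms.projectiveSpaceFst ι T)).obj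
        (twistMod (i ≫ pullback.snd (terminal.from T) (terminal.from (Morphisms.projectiveSpaceInt ι))) (unitModule Z) m), ⊤) from
        monomialSection (i ≫ pullback.snd (terminal.from T) (terminal.from (Morphisms.projectiveSpaceInt ι))) m w))
  (ψW : ∀ m : ℕ, freeModule T (Fin m → Fin (Nat.card ι + 1)) ⟶ (Scheme.Modules.pushforward (iW ≫ Morphisms.projectiveSpaceFst ι T)).obj
    (twistMod (iW ≫ pullback.snd (terminal.from T) (terminal.from (Morphisms.projectiveSpaceInt ι))) (unitModule W) m))
  (hψW : ∀ (m : ℕ) (w : Fin m → Fin (Nat.card ι + 1)) (V : T.Opens), (ψW m).app V (freeSectionOn T w V) =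
    ((Scheme.Modules.pushforward (iW ≫ Morphisms.projectiveSpaceFst ι T)).obj
      (twistMod (iW ≫ pullback.snd (terminal.from T) (terminal.from (Morphisms.projectiveSpaceInt ι))) (unitModule W) m)).presheaf.map
      (homOfLE (le_top : V ≤ ⊤)).op
      (show Γ((Scheme.Modules.pushforward (iW ≫ Morphisms.projectiveSpaceFst ι T)).obj
        (twistMod (iW ≫ pullback.snd (terminal.from T) (terminal.from (Morphisms.projectiveSpaceInt ι))) (unitModule W) m), ⊤) from
        monomialSection (iW ≫ pullback.snd (terminal.from T) (terminal.from (Morphisms.projectiveSpaceInt ι))) m w))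
  (m₀ : ℕ)

include hψZ hψW in
/-- **THE AFFINE CORE: if the restricted forms die after base change, the sub-family lies in `W` after base change.**  Let `Z, W ⊂ 𝐏(ι; T)` be
closed with monomial maps `ψ_{Z,m}`, `ψ_{W,m}`, let `x : Spec A → T` be an OPEN IMMERSION with `A` Noetherian (an affine open of a locally Noetherian
`T`), and `A → A'` any algebra, `x' := Spec A' → Spec A → T`.  If `x'^* (kernel.ι ψ_{W,m} ≫ ψ_{Z,m}) = 0` for every `m ≥ m₀`, then
`𝓘_W · 𝒪_{𝐏(ι; Spec A')} ≤ 𝓘_Z · 𝒪_{𝐏(ι; Spec A')}` (pull-backs along `𝐏(x')`), i.e. `Z_{A'} ⊂ W_{A'}`.  Proof: `𝔞(W_A)` is generated in degrees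
`≤ d₀` (`A` Noetherian); for `m = max(m₀, d₀)` and `g ∈ 𝔞(W_A)`, `g_m = Σ_w a_w x^w` is a relation `Σ_w a_w • μ_w|_{W_A} = 0` (§2 (W): it comes
from a section `s` of `K_W(m)` over `x(⊤)`), so `x'^* α_m = 0` gives `η_{x'}(ψ_Z(s)) = 0` and §2 (Z) puts `g_m ⊗ 1` in `𝔞(Z_{A'})`; ★ FILE 2B
`ker_le_ker_comp_projMap_of_map_hcomp_mem` then yields `𝓘(W_A) ≤ 𝓘(Z_{A'} → ℙⁿ_A)`, which is the claim transported along `ℙⁿ_{A'} ≅ 𝐏(ι; Spec A')`.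
[cite: Kollar1996, I Thm. 1.10 (proof)] [cite: MumfordFogartyKirwan1994, Ch. 0 §5 (c) (p. 23)] [cite: Hartshorne1977, II Ex. 5.10 (p. 125) and II Cor. 5.16 (a) (p. 119)] -/
theorem ker_comap_le_of_forall_pullback_map_eq_zero_affine {A : Type} [CommRing A] [IsNoetherianRing A]
    (x : Spec (CommRingCat.of A) ⟶ T) [IsOpenImmersion x] (A' : Type) [CommRing A'] [Algebra A A']
    (h : ∀ m, m₀ ≤ m →
      (Scheme.Modules.pullback (Spec.map (CommRingCat.ofHom (algebraMap A A')) ≫ x)).map (kernel.ι (ψW m) ≫ ψZ m) = 0) :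
    iW.ker.comap (Morphisms.projectiveSpaceMap ι (Spec.map (CommRingCat.ofHom (algebraMap A A')) ≫ x)) ≤
      i.ker.comap (Morphisms.projectiveSpaceMap ι (Spec.map (CommRingCat.ofHom (algebraMap A A')) ≫ x)) := by
  classical
  letI := MvPolynomial.gradedAlgebra (σ := Fin (Nat.card ι + 1)) (R := A)
  letI := MvPolynomial.gradedAlgebra (σ := Fin (Nat.card ι + 1)) (R := A')
  obtain ⟨kP, HC, WA, kXW, ιWA, _, SW, hTW, X₁, kX', ι', _, SZ, hTZ⟩ := exists_presentations i iW x A'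
  -- `𝔞(W_A)` is finitely generated (`A` Noetherian): the bound `d₀` and the degree `d := max m₀ d₀`
  obtain ⟨S, hS⟩ := (isNoetherian_def.mp (inferInstance : IsNoetherian (P A (Nat.card ι)) (P A (Nat.card ι)))) (idealZ ιWA)
  obtain ⟨ΦW, hΦW⟩ := hTW (max m₀ (S.sup MvPolynomial.totalDegree))
  obtain ⟨Φ, hΦ⟩ := hTZ (max m₀ (S.sup MvPolynomial.totalDegree))
  -- the squares over `x` and `x' = Spec A' → Spec A → T`
  have Hκ := ProjBaseChangeRing.isPullback_projMap' A A' (n := Nat.card ι)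
  have HC' : IsPullback (Proj.map (ProjBaseChangeRing.mapGraded A A' (Fin (Nat.card ι + 1)))
        (ProjBaseChangeRing.irrelevant_le_map A A' (Fin (Nat.card ι + 1))) ≫ kP) (toSpec A' (Nat.card ι))
      (Morphisms.projectiveSpaceFst ι T) (Spec.map (CommRingCat.ofHom (algebraMap A A')) ≫ x) := Hκ.paste_horiz HC
  have HW : IsPullback kXW (ιWA ≫ toSpec A (Nat.card ι)) (iW ≫ Morphisms.projectiveSpaceFst ι T) x := SW.flip.paste_vert HC
  have HZ : IsPullback kX' (ι' ≫ toSpec A' (Nat.card ι)) (i ≫ Morphisms.projectiveSpaceFst ι T)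
      (Spec.map (CommRingCat.ofHom (algebraMap A A')) ≫ x) := SZ.flip.paste_vert HC'
  have hle : (⊤ : (Spec (CommRingCat.of A)).Opens) ≤ x ⁻¹ᵁ (x ''ᵁ ⊤) := (x.preimage_image_eq ⊤).ge
  have hle' : (⊤ : (Spec (CommRingCat.of A')).Opens) ≤ (Spec.map (CommRingCat.ofHom (algebraMap A A')) ≫ x) ⁻¹ᵁ (x ''ᵁ ⊤) :=
    fun p _ => ⟨_, trivial, rfl⟩
  -- the forms of `𝔞(W_A)` in degree `d` map into `𝔞(Z_{A'})`
  have hforms : ∀ g ∈ idealZ ιWA, MvPolynomial.map (algebraMap A A') (hcomp ((max m₀ (S.sup MvPolynomial.totalDegree) : ℕ) : ℤ) g) ∈ idealZ ι' := by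
    intro g hg
    obtain ⟨a, ha⟩ := exists_wordPolynomial_eq_hcomp g (max m₀ (S.sup MvPolynomial.totalDegree))
    have hgd := hcomp_mem_idealZ ιWA hg ((max m₀ (S.sup MvPolynomial.totalDegree) : ℕ) : ℤ)
    rw [ha] at hgd ⊢
    -- coefficients on `T` over `V := x(⊤)`
    set cT : (Fin (max m₀ (S.sup MvPolynomial.totalDegree)) → Fin (Nat.card ι + 1)) → Γ(T, x ''ᵁ ⊤) :=
      fun w => (x.appIso ⊤).inv ((Scheme.ΓSpecIso (CommRingCat.of A)).inv (a w)) with hcT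
    have hcW : ∀ w, (Scheme.ΓSpecIso (CommRingCat.of A)).hom (x.appLE (x ''ᵁ ⊤) ⊤ hle (cT w)) = a w := fun w => by
      rw [hcT, appLE_appIso_inv_top, CategoryTheory.Iso.inv_hom_id_apply]
    have hcZ : ∀ w, (Scheme.ΓSpecIso (CommRingCat.of A')).hom
        ((Spec.map (CommRingCat.ofHom (algebraMap A A')) ≫ x).appLE (x ''ᵁ ⊤) ⊤ hle' (cT w)) = algebraMap A A' (a w) := fun w => by
      rw [ΓSpecIso_hom_comp_appLE_top _ x hle hle', hcW]
      rfl
    -- W-side: the relation `Σ_w a_w • μ_w|_{W_A} = 0` comes from a section `s` of `K_W(d)` over `x(⊤)`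
    have hσ : (ψW _).app (x ''ᵁ ⊤) (∑ w, cT w • freeSectionOn T w (x ''ᵁ ⊤)) = 0 := by
      refine app_monomialMap_eq_zero_of_wordPolynomial_mem_idealZ iW _ (ψW _) (hψW _) HW ΦW hΦW hle cT ?_
      simp_rw [hcW]
      exact hgd
    obtain ⟨s, hs⟩ := exists_kernel_ι_app_eq (ψW _) (x ''ᵁ ⊤) _ hσ
    -- Z-side: `x'^* α_d = 0` kills `η_{x'}(ψ_Z(σ))`
    have h0 : unitSectionLE (Spec.map (CommRingCat.ofHom (algebraMap A A')) ≫ x)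
        ((Scheme.Modules.pushforward (i ≫ Morphisms.projectiveSpaceFst ι T)).obj
          (twistMod (i ≫ pullback.snd (terminal.from T) (terminal.from (Morphisms.projectiveSpaceInt ι))) (unitModule Z) _)) hle'
        ((ψZ _).app (x ''ᵁ ⊤) (∑ w, cT w • freeSectionOn T w (x ''ᵁ ⊤))) = 0 := by
      rw [← hs, ← CategoryTheory.comp_apply, ← Scheme.Modules.Hom.comp_app, ← pullback_map_app_unitSectionLE, h _ (le_max_left _ _),
        Scheme.Modules.Hom.zero_app]
      rfl
    have hmem := wordPolynomial_mem_idealZ_of_unitSectionLE_app_eq_zero i _ (ψZ _) (hψZ _) HZ Φ hΦ hle' cT h0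
    simp_rw [hcZ] at hmem
    simpa only [map_sum, map_mul, MvPolynomial.map_C, map_prod, MvPolynomial.map_X] using hmem
  -- ★ FILE 2B: `𝓘(W_A) ≤ 𝓘(Z_{A'} → ℙⁿ_A)`
  have hcont := ker_le_ker_comp_projMap_of_map_hcomp_mem ιWA ι' hS (fun g hg => (Finset.le_sup hg).trans (le_max_right _ _)) hforms
  -- transport along `ℙⁿ_{A'} ≅ 𝐏(ι; Spec A')` (two cartesian lifts over `x'`)
  have H2 := Morphisms.isPullback_projectiveSpaceMap ι (Spec.map (CommRingCat.ofHom (algebraMap A A')) ≫ x)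
  have he := HC'.isoIsPullback_hom_fst _ _ H2
  have hx' : Morphisms.projectiveSpaceMap ι (Spec.map (CommRingCat.ofHom (algebraMap A A')) ≫ x) =
      (HC'.isoIsPullback _ _ H2).inv ≫ Proj.map (ProjBaseChangeRing.mapGraded A A' (Fin (Nat.card ι + 1)))
        (ProjBaseChangeRing.irrelevant_le_map A A' (Fin (Nat.card ι + 1))) ≫ kP :=
    (Iso.eq_inv_comp _).mpr he
  have hcomap : ∀ J : (Morphisms.projectiveSpace ι T).IdealSheafData,
      J.comap (Morphisms.projectiveSpaceMap ι (Spec.map (CommRingCat.ofHom (algebraMap A A')) ≫ x)) =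
        ((J.comap kP).comap (Proj.map (ProjBaseChangeRing.mapGraded A A' (Fin (Nat.card ι + 1)))
          (ProjBaseChangeRing.irrelevant_le_map A A' (Fin (Nat.card ι + 1))))).comap (HC'.isoIsPullback _ _ H2).inv := fun J => by
    rw [← Scheme.IdealSheafData.comap_comp, ← Scheme.IdealSheafData.comap_comp]
    exact congrArg _ hx'
  rw [hcomap, hcomap]
  refine Scheme.IdealSheafData.comap_mono _ ?_
  rw [← ker_eq_comap_ker_of_isPullback SW, ← Scheme.IdealSheafData.comap_comp, ← ker_eq_comap_ker_of_isPullback SZ]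
  exact Scheme.IdealSheafData.le_map_iff_comap_le.mp (hcont.trans (Scheme.IdealSheafData.map_ker ι' _).ge)

end Core

end Literature.AlgebraicGeometry.Motives

end
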